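import Summits.BirchSwinnertonDyer.Rank1Residual.Additive.GordChiBranchKatoComponent
import Summits.BirchSwinnertonDyer.Rank1Residual.AdditivePotMult.Twist
import Literature.NumberTheory.EllipticCurves.Wuthrich2014.ReducibleDivisibilityCyclotomicPrimeComponent
import HarnessLib

/-!
# Brick 5′ (reducible): the typed `χ_p`-branch inputs `ChiBranchLeadingTerm[Odd]At W p` are
# THEOREMS at every odd `p` for `W` potentially good at `p`, from the componentwise reading of
# Wuthrich 2014 Thm. 16 + the kernel transport [C] (cell `b2b-bsdres`, sub-cell additive-p2, gen 12)

HONEST FRAMING (cell `b2b-bsdres`, run/shared/lean/b2b/bsd-rank1-residual/, verbatim in every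
file): the goal of the cell is to DELETE the COMBINATION-SHAPED residual classes of the
Birch–Swinnerton-Dyer formula for ALL analytic-rank `≤ 1` elliptic curves over `ℚ` — "full BSD
formula for every rank `≤ 1` curve in class `C`" assembled STRICTLY from published theorems — so
that the rank-`≤ 1` remainder becomes exactly the CONSTRUCTION-SHAPED classes, which are TYPED
(missing-input `Prop`s), NOT attempted. This is not "finishing BSD". Sub-cell `additive-p2`
(CLASS-OWNERS row "X3/X4 additive — pot. good ordinary / X3♯(G-ord)"), generation 12: research
route; no claim beyond the stated classes; X3♯(G-ord)/X4♯(G-ord) stay CONSTRUCTION-SHAPED; labels /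
census / located gap UNCHANGED; nothing is booked. Theorems only (no definition, no new named fact;
ONE named fact enters as a HYPOTHESIS: `Wuthrich2014.charIdeal_dvd_padicLFunctionBranch_component`,
the component `i = (p−1)/2` reading of Wuthrich's Thm. 16 (good ordinary, `E[p]` reducible), file
`Literature/…/Wuthrich2014/ReducibleDivisibilityCyclotomicPrimeComponent.lean`).

WHAT. The reducible twin of `GordChiBranchKatoComponent.lean`: additive-p4's typed predicates
`ChiBranchLeadingTermOddAt W p` (`p ≡ 3 (mod 4)`) and `ChiBranchLeadingTermAt W p` (`p ≡ 1 (mod 4)`)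
— "[B∘C] at `T = 0`" for a twist with `E[p]` REDUCIBLE (the X3 situation) — become theorems for every
`W` with `0 ≤ ord_p j(W)` (potentially good at `p`; the whole (G)-cell), GIVEN the component
reading-fact: `chiBranchLeadingTermOddAt_of_wuthrichComponent`,
`chiBranchLeadingTermAt_of_wuthrichComponent`. Same kernel chain (vacuous multiplicative disjunct;
`K = ℚ(√p*) ⊂ F = ℚ(ζ_p)`; additive-p1's [C]; additive-p2's eigen-descent and generator
normalisation; `T = 0` by additive-p4's constant-term theorems; `α ∈ ℤ_p^×`), with `V[p]` reducible
from `W[p]` reducible (`irr_iff_of_model_twist`). Consumers: additive-p2's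
`ClassX3Gord.missingUpperBoundAt_rankZero_of_chiBranch[']`, additive-p4's X3 line V9, at EVERY odd
`p` — see `GordRankZeroKatoComponent.lean`. The LOWER (Eisenstein) half is untouched; labels
UNCHANGED; nothing booked.

References: C. Wuthrich, Doc. Math. 19 (2014) Thm. 16, §3, §5 [Wuthrich2014]; R. Greenberg, LNM
1716 (1999) §5 p. 143 [GreenbergLNM1716]; B. Mazur, J. Tate, J. Teitelbaum, Invent. Math. 84 (1986)
§I.13–I.14 [MazurTateTeitelbaum1986Invent].
-/

noncomputable section

open scoped Classical MatrixGroups ModularForm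

namespace Summit.BirchSwinnertonDyer.Rank1Residual.Additive

open CongruenceSubgroup WeierstrassCurve Literature.NumberTheory.EllipticCurves
  Literature.NumberTheory.EllipticCurves.ModularForms Literature.NumberTheory.EllipticCurves.Rank1Residual
  Literature.NumberTheory.GaloisRepresentations Summit.BirchSwinnertonDyer.Rank1Residual.AdditivePotMult

/-! ## §1 `ChiBranchLeadingTermOddAt W p` from the Wuthrich component fact (`p ≡ 3 (mod 4)`) -/

section OddRed

variable (W : WeierstrassCurve ℚ) [W.IsElliptic] (p : ℕ) [hp : Fact p.Prime]

/-- **Brick 5′, odd branch, reducible.** For `W/ℚ` potentially good at `p` (`0 ≤ ord_p j(W)`; e.g.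
the (G)-cell), the typed input `ChiBranchLeadingTermOddAt W p` of additive-p4's line V9 HOLDS, given the
component `i = (p−1)/2` reading of Wuthrich 2014 Thm. 16
(`Wuthrich2014.charIdeal_dvd_padicLFunctionBranch_component`): for every globally minimal `V`, good
ordinary or multiplicative at `p` (the multiplicative case is vacuous), with `C • V^{(−p)} = W`, `W[p]`
(hence `V[p]`) reducible, every cyclotomic `κ/γ` and every `Λ`-dual datum `D` of `Sel_{p^∞}(W/ℚ_∞)`:
`X(W/ℚ_∞)` is `Λ`-torsion and some `g ∈ char_Λ X(W/ℚ_∞)` has `g(0) = u·ϖ⁻·∑_a (a/p)[a/p]⁻_f`. Same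
kernel chain as the big-image twin. [cite: Wuthrich2014, Thm. 16 (p. 397)]
[cite: GreenbergLNM1716, §5 p. 143] [cite: MazurTateTeitelbaum1986Invent, §I.13–I.14] -/
theorem chiBranchLeadingTermOddAt_of_wuthrichComponent
    (hK : Wuthrich2014.charIdeal_dvd_padicLFunctionBranch_component)
    (hj : 0 ≤ padicValRat p W.j) : ChiBranchLeadingTermOddAt W p := by
  intro V _ _ κ γ N _ f hp3 hCW hred hredW hκ hγ hcv hf D ϖ hϖ
  have hp2 : p ≠ 2 := by rintro rfl; norm_num at hp3
  have hpne : (-(p : ℚ)) ≠ 0 := neg_ne_zero.mpr (Nat.cast_ne_zero.mpr hp.out.ne_zero)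
  have hodd : ¬ Even (p / 2) := by rw [Nat.not_even_iff_odd]; exact ⟨p / 4, by omega⟩
  -- `V` is good ordinary
  have hord : IsOrdinaryAt V p := isOrdinaryAt_of_goodOrd_or_mult_of_model_twist W V hpne hCW hj hred
  obtain ⟨C, hC⟩ := hCW
  -- the fields `F = ℚ(ζ_p) ⊇ K = ℚ(√−p)`
  haveI hcycL : IsCyclotomicExtension {p} ℚ (CyclotomicField p ℚ) := by
    have h : (CyclotomicField.algebra p ℚ : Algebra ℚ (CyclotomicField p ℚ)) =
        DivisionRing.toRatAlgebra := Subsingleton.elim _ _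
    exact h ▸ CyclotomicField.isCyclotomicExtension p ℚ
  obtain ⟨K, θ, hK2, hθ, hθ2⟩ := exists_intermediateField_sq_eq_pStar p (CyclotomicField p ℚ) hp2
  haveI : NumberField K := NumberField.of_module_finite ℚ K
  have hcK : θ ^ 2 = algebraMap ℚ K (-(p : ℚ)) := by
    rw [hθ2, pStar_eq_neg_of_mod_four_eq_three hp3]
  haveI : IsGalois ℚ K := isGalois_of_finrank_eq_two K hK2
  haveI := normal_galRange K hK2 (sigmaQ_ne_one K hK2 hθ hcK)
  haveI := normal_galRange_cyclotomic p (CyclotomicField p ℚ)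
  haveI : (V.quadraticTwist (-(p : ℚ))).IsElliptic := V.isElliptic_quadraticTwist hpne
  -- the `Λ`-dual datum of `e_{(p−1)/2} Sel(V/ℚ(μ_{p^∞}))` at a normalised generator, same `char`
  obtain ⟨γ', hγ'KF, hκγ', ⟨g₀, hg₀, hγ'eq⟩, D', hchar, htor⟩ :=
    SelmerDualData.exists_chiEigenInCyclotomic p (CyclotomicField p ℚ) V K hK2 hθ hcK κ hC hp2 D
  -- the fact, applied to that datum
  obtain ⟨htorX, g, hgmem, u, hιg⟩ := hK p V K (CyclotomicField p ℚ) (κ := κ) (γ := γ') (f := f)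
    (chiEigenSelmerIn V K p κ (galRange (K := ℚ) (CyclotomicField p ℚ)))
    (fun t ht ↦ conjH1_mem_chiEigenSelmerIn γ' ht) D'.X D'.toDual hp2 hK2 ⟨θ, hθ2⟩ hord
    (fun hV ↦ hredW ((irr_iff_of_model_twist (W := V) (p := p) hpne ⟨C, hC⟩).mpr hV)) hκ
    (isTopGenerator_of_kappa_eq κ hκγ' hγ)
    (isCyclotomicVariable_of_eq_mul p κ hκ hg₀ hγ'eq hcv)
    (Subgroup.mem_inf.mp hγ'KF).1 (Subgroup.mem_inf.mp hγ'KF).2 hf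
    (mem_chiEigenSelmerIn_iff_ite V K κ _) D'.bijective D'.toDual_T_smul D'.toDual_C_smul ϖ
    (by rw [if_neg hodd]; exact hϖ)
  refine ⟨htor.mp htorX, g, hchar ▸ hgmem, ?_⟩
  -- `T = 0`: `g(0) = u ϖ · α⁻¹ ∑ (a/p)[a/p]⁻`
  obtain ⟨-, hunit⟩ := unitRoot_spec_holds V p hord
  obtain ⟨ua, hua⟩ := hunit
  refine ⟨u * ua⁻¹, ?_⟩
  have h0 := congrArg PowerSeries.constantCoeff hιg
  rw [constantCoeff_iwasawaToPowerSeries, if_neg hodd, map_mul, PowerSeries.constantCoeff_C,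
    constantCoeff_padicLFunctionMinusBranch_half p hp2 V hord hf, ← hua] at h0
  rw [h0, Units.val_mul, PadicInt.coe_mul, coe_units_inv_eq_inv]
  ring

end OddRed

/-! ## §2 `ChiBranchLeadingTermAt W p` from the Wuthrich component fact (`p ≡ 1 (mod 4)`) -/

section EvenRed

variable (W : WeierstrassCurve ℚ) [W.IsElliptic] (p : ℕ) [hp : Fact p.Prime]

/-- **Brick 5′, even branch, reducible.** For `W/ℚ` potentially good at `p` (`0 ≤ ord_p j(W)`), the
typed input `ChiBranchLeadingTermAt W p` (`p ≡ 1 (mod 4)`, twist by `p = p*`, `W[p]` reducible) HOLDS,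
given the component `i = (p−1)/2` reading of Wuthrich 2014 Thm. 16: same chain, PLUS branch,
additive-p4's `constantCoeff_padicLFunctionBranch_half`. [cite: Wuthrich2014, Thm. 16 (p. 397)]
[cite: GreenbergLNM1716, §5 p. 143] [cite: MazurTateTeitelbaum1986Invent, §I.13–I.14] -/
theorem chiBranchLeadingTermAt_of_wuthrichComponent
    (hK : Wuthrich2014.charIdeal_dvd_padicLFunctionBranch_component)
    (hj : 0 ≤ padicValRat p W.j) : ChiBranchLeadingTermAt W p := by
  intro V _ _ κ γ N _ f hp1 hCW hred hredW hκ hγ hcv hf D ϖ hϖ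
  have hp2 : p ≠ 2 := by rintro rfl; norm_num at hp1
  have hpne : (p : ℚ) ≠ 0 := Nat.cast_ne_zero.mpr hp.out.ne_zero
  have heven : Even (p / 2) := ⟨p / 4, by omega⟩
  have hord : IsOrdinaryAt V p := isOrdinaryAt_of_goodOrd_or_mult_of_model_twist W V hpne hCW hj hred
  obtain ⟨C, hC⟩ := hCW
  haveI hcycL : IsCyclotomicExtension {p} ℚ (CyclotomicField p ℚ) := by
    have h : (CyclotomicField.algebra p ℚ : Algebra ℚ (CyclotomicField p ℚ)) =
        DivisionRing.toRatAlgebra := Subsingleton.elim _ _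
    exact h ▸ CyclotomicField.isCyclotomicExtension p ℚ
  obtain ⟨K, θ, hK2, hθ, hθ2⟩ := exists_intermediateField_sq_eq_pStar p (CyclotomicField p ℚ) hp2
  haveI : NumberField K := NumberField.of_module_finite ℚ K
  have hcK : θ ^ 2 = algebraMap ℚ K (p : ℚ) := by
    rw [hθ2, pStar_eq_self_of_mod_four_eq_one hp1]
  haveI : IsGalois ℚ K := isGalois_of_finrank_eq_two K hK2
  haveI := normal_galRange K hK2 (sigmaQ_ne_one K hK2 hθ hcK)
  haveI := normal_galRange_cyclotomic p (CyclotomicField p ℚ)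
  haveI : (V.quadraticTwist (p : ℚ)).IsElliptic := V.isElliptic_quadraticTwist hpne
  obtain ⟨γ', hγ'KF, hκγ', ⟨g₀, hg₀, hγ'eq⟩, D', hchar, htor⟩ :=
    SelmerDualData.exists_chiEigenInCyclotomic p (CyclotomicField p ℚ) V K hK2 hθ hcK κ hC hp2 D
  obtain ⟨htorX, g, hgmem, u, hιg⟩ := hK p V K (CyclotomicField p ℚ) (κ := κ) (γ := γ') (f := f)
    (chiEigenSelmerIn V K p κ (galRange (K := ℚ) (CyclotomicField p ℚ)))
    (fun t ht ↦ conjH1_mem_chiEigenSelmerIn γ' ht) D'.X D'.toDual hp2 hK2 ⟨θ, hθ2⟩ hord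
    (fun hV ↦ hredW ((irr_iff_of_model_twist (W := V) (p := p) hpne ⟨C, hC⟩).mpr hV)) hκ
    (isTopGenerator_of_kappa_eq κ hκγ' hγ)
    (isCyclotomicVariable_of_eq_mul p κ hκ hg₀ hγ'eq hcv)
    (Subgroup.mem_inf.mp hγ'KF).1 (Subgroup.mem_inf.mp hγ'KF).2 hf
    (mem_chiEigenSelmerIn_iff_ite V K κ _) D'.bijective D'.toDual_T_smul D'.toDual_C_smul ϖ
    (by rw [if_pos heven]; exact hϖ)
  refine ⟨htor.mp htorX, g, hchar ▸ hgmem, ?_⟩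
  obtain ⟨-, hunit⟩ := unitRoot_spec_holds V p hord
  obtain ⟨ua, hua⟩ := hunit
  refine ⟨u * ua⁻¹, ?_⟩
  have h0 := congrArg PowerSeries.constantCoeff hιg
  rw [constantCoeff_iwasawaToPowerSeries, if_pos heven, map_mul, PowerSeries.constantCoeff_C,
    constantCoeff_padicLFunctionBranch_half p hp2 V hord hf, ← hua] at h0
  rw [h0, Units.val_mul, PadicInt.coe_mul, coe_units_inv_eq_inv]
  ring

end EvenRed

/-! ## §3 On the (G)-cell -/

section Gord

variable (W : WeierstrassCurve ℚ) [W.IsElliptic] (p : ℕ) [hp : Fact p.Prime]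

/-- **On the (G)-cell** (Delbourgo's (G), `TypeG W p`, in particular on X3♯(G-ord)) both reducible
branch inputs hold, given the Wuthrich component fact (`ord_p j ≥ 0` by gen 2's
`padicValRat_j_nonneg_of_typeG`). [cite: Wuthrich2014, Thm. 16 (p. 397)] -/
theorem TypeG.chiBranchLeadingTermAt_and_odd_of_wuthrichComponent
    (hK : Wuthrich2014.charIdeal_dvd_padicLFunctionBranch_component) (hG : TypeG W p) :
    ChiBranchLeadingTermAt W p ∧ ChiBranchLeadingTermOddAt W p :=
  ⟨chiBranchLeadingTermAt_of_wuthrichComponent W p hK (padicValRat_j_nonneg_of_typeG W p hG),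
    chiBranchLeadingTermOddAt_of_wuthrichComponent W p hK (padicValRat_j_nonneg_of_typeG W p hG)⟩

end Gord

end Summit.BirchSwinnertonDyer.Rank1Residual.Additive

end
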